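import Mathlib.Analysis.SpecialFunctions.SmoothTransition
import Mathlib.Analysis.SpecialFunctions.Pow.Real
import Mathlib.Analysis.SpecialFunctions.Sqrt
import Mathlib.Analysis.Complex.RealDeriv
import Mathlib.Analysis.Calculus.FDeriv.Comp
import Mathlib.Analysis.Calculus.Deriv.Comp
import Mathlib.Analysis.Calculus.Deriv.MeanValue
import HarnessLib

/-!
# The planar model of a `1`-handle seam: the loops `y² + 2wy + p(x) = c`

Topic `Literature/Topology/FourManifolds` (uniqueness half of spc4.S33,
`Literature.Topology.FourManifolds.nonempty_diffeomorph_of_homeomorph_of_le_three`, leaf `n = 2`,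
Hatcher's route: A. Hatcher, *The Kirby torus trick for surfaces* (2013/2025), Handle Smoothing
Theorem **(1)** — "An embedding `D¹ × ℝ → S` which is a smooth embedding near `∂D¹ × ℝ` can be
isotoped to be a smooth embedding in a neighborhood of `D¹ × 0`, staying fixed outside a larger
neighborhood of `D¹ × 0` and near `∂D¹ × ℝ`").  Hatcher deduces (1) from his Fact 5 (Morse theory
on the strip).  The tree's proof of the static form of (1) (files `HandleOne*.lean`) instead
realises the core segment `[-1, 1] × {0}` as the top edge of an explicit smooth loop, approximates
the loop's defining function by one which is smooth for the pulled-back structure and has `0` as a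
regular value, extracts from the zero level a smooth arc through the two ends of the core (the
top arc of the level circle), thickens it to a product chart aligned with the given chart on the
end zones, and plumbs that chart in by planar topology; this file is the **explicit planar
model** of that argument — elementary real analysis, no manifolds.  **Everything is proved; no
named fact; the only definitions are the explicit model functions and constants.**

With `w = 1/8` and, for a parameter `η > 0` (the width of the end zones `|x| > 1 - η`),
`κ = (w² + 1) e^{4/η}`, `p(x) = κ (E(x - 1) + E(-x - 1))` (`E = expNegInvGlue`, so `p = 0` on
`[-1, 1]`, `p` even, increasing for `x > 1`), the model function is

  `v₀(x + iy) = y² + 2 w y + p(x) = (y + w)² - w² + p(x)`.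

* `HandleOne.w`, `HandleOne.eps` (`ε = w²/16`), `HandleOne.kap`, `HandleOne.pf`, `HandleOne.pf'`,
  `HandleOne.v0`: the constants and model functions; smoothness (`contDiff_pf`, `contDiff_v0`),
  values and derivatives (`pf_eq_zero`, `pf_neg`, `pf_pos`, `hasDerivAt_pf`, `pf'_pos`,
  `pf_lt_pf`, `hasFDerivAt_v0`, `fderiv_v0_apply`, `fderiv_v0_eq_zero_iff`: the critical points
  are exactly `{y = -w, |x| ≤ 1}`, with value `-w²`, `fderiv_v0_ne_zero_of_lt`);
* the levels in the middle region `|x| ≤ 1`: `v0_eq_iff_of_abs_re_le_one` (two horizontal lines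
  `y = yt c := -w + √(w² + c)` and `y = yb c := -w - √(w² + c)`), `v0_le_iff_of_abs_re_le_one`,
  `le_v0_iff_of_abs_re_le_one`, monotonicity of `yt`, `yb` (`yt_lt_yt`, `yb_lt_yb`),
  `yt_zero : yt 0 = 0` (the core is the top edge of the zero loop), `v0_ofReal`;
* a priori bounds: `pf_ge_of_le_abs` (`p ≥ w² + 1` for `|x| ≥ 1 + η/4`), `abs_re_lt_of_v0_lt_one`
  (the loops `v₀ < 1` lie in `|x| < 1 + η/4`), `v0_ge_of_one_le_abs_im`, `one_le_v0_of_le_abs_re`,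
  `abs_im_lt_one_of_abs_v0_lt`, `abs_im_le_or_of_abs_v0_le` (in `|x| ≤ 1` the thin set
  `|v₀| ≤ 3ε` splits into the two strips `|y| ≤ w/8` and `|y + 2w| ≤ w/8`), `not_both_strips`.

## References

* A. Hatcher, *The Kirby torus trick for surfaces*, arXiv:1312.3518 (2013); L'Enseignement
  Math. 72 (2025) 161–174: Handle Smoothing Theorem (1), "Smoothing 1-handles", Fact 5.
  [Hatcher2025]
-/

noncomputable section

open Set Real Polynomial
open scoped ContDiff Topology

namespace Literature.Topology.FourManifolds

namespace HandleOne

/-! ### Constants -/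

/-- Half the distance between the two horizontal edges of the model loops: `w = 1/8`. [folklore] -/
def w : ℝ := 1 / 8

/-- `w = 1/8`. [folklore] -/
theorem w_eq : w = 1 / 8 := rfl

/-- `0 < w`. [folklore] -/
theorem w_pos : 0 < w := by rw [w_eq]; norm_num

/-- `w < 1/4`. [folklore] -/
theorem w_lt : w < 1 / 4 := by rw [w_eq]; norm_num

/-- The thinness parameter `ε = w² / 16`. [folklore] -/
def eps : ℝ := w ^ 2 / 16

/-- `0 < ε`. [folklore] -/
theorem eps_pos : 0 < eps := by unfold eps; exact div_pos (pow_pos w_pos 2) (by norm_num)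

/-- `ε = w²/16`. [folklore] -/
theorem eps_eq : eps = w ^ 2 / 16 := rfl

/-! ### The derivative of `expNegInvGlue` -/

/-- The derivative of Mathlib's `expNegInvGlue` at every point: `x⁻² · expNegInvGlue x` (the case
`p = 1` of `expNegInvGlue.hasDerivAt_polynomial_eval_inv_mul`). [folklore] -/
theorem hasDerivAt_expNegInvGlue (x : ℝ) :
    HasDerivAt expNegInvGlue (x⁻¹ ^ 2 * expNegInvGlue x) x := by
  have h := expNegInvGlue.hasDerivAt_polynomial_eval_inv_mul 1 x
  simp only [eval_one, one_mul, derivative_one, sub_zero, mul_one, eval_pow, eval_X] at h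
  exact h

/-- `expNegInvGlue` has positive derivative at positive points. [folklore] -/
theorem deriv_expNegInvGlue_pos {x : ℝ} (hx : 0 < x) : 0 < x⁻¹ ^ 2 * expNegInvGlue x :=
  mul_pos (pow_pos (inv_pos.2 hx) 2) (expNegInvGlue.pos_of_pos hx)

/-- `expNegInvGlue` is strictly increasing on `[0, ∞)`. [folklore] -/
theorem expNegInvGlue_lt_of_lt {x y : ℝ} (hx : 0 ≤ x) (hxy : x < y) :
    expNegInvGlue x < expNegInvGlue y := by
  rcases hx.eq_or_lt with rfl | hx0
  · rw [expNegInvGlue.zero]; exact expNegInvGlue.pos_of_pos hxy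
  · -- mean value on `[x, y]`
    have hderiv : ∀ z ∈ Icc x y, HasDerivAt expNegInvGlue (z⁻¹ ^ 2 * expNegInvGlue z) z :=
      fun z _ => hasDerivAt_expNegInvGlue z
    have hpos : ∀ z ∈ interior (Icc x y), 0 < deriv expNegInvGlue z := by
      intro z hz
      rw [interior_Icc] at hz
      rw [(hasDerivAt_expNegInvGlue z).deriv]
      exact deriv_expNegInvGlue_pos (hx0.trans hz.1)
    exact strictMonoOn_of_deriv_pos (convex_Icc x y)
      (expNegInvGlue.contDiff (n := 0)).continuous.continuousOn hpos ⟨le_rfl, hxy.le⟩ ⟨hxy.le, le_rfl⟩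
      hxy

/-- The value of `expNegInvGlue` at a positive point. [folklore] -/
theorem expNegInvGlue_of_pos {x : ℝ} (hx : 0 < x) : expNegInvGlue x = exp (-x⁻¹) := by
  simp [expNegInvGlue, not_le.2 hx]

/-! ### The profile `p` -/

variable (η : ℝ)

/-- The coefficient `κ = (w² + 1) e^{4/η}`. [folklore] -/
def kap : ℝ := (w ^ 2 + 1) * exp (4 / η)

/-- `0 < κ`. [folklore] -/
theorem kap_pos : 0 < kap η := mul_pos (by positivity) (exp_pos _)

/-- The profile `p(x) = κ (E(x - 1) + E(-x - 1))`: zero on `[-1, 1]`, even, increasing for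
`x > 1`. [folklore] -/
def pf (x : ℝ) : ℝ := kap η * (expNegInvGlue (x - 1) + expNegInvGlue (-x - 1))

/-- `p` is even. [folklore] -/
theorem pf_neg (x : ℝ) : pf η (-x) = pf η x := by
  unfold pf; rw [neg_neg, add_comm (expNegInvGlue (-x - 1))]

/-- `p = 0` on `[-1, 1]`. [folklore] -/
theorem pf_eq_zero {x : ℝ} (hx : |x| ≤ 1) : pf η x = 0 := by
  rw [abs_le] at hx
  unfold pf
  rw [expNegInvGlue.zero_of_nonpos (by linarith), expNegInvGlue.zero_of_nonpos (by linarith),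
    add_zero, mul_zero]

/-- `0 ≤ p`. [folklore] -/
theorem pf_nonneg (x : ℝ) : 0 ≤ pf η x :=
  mul_nonneg (kap_pos η).le (add_nonneg (expNegInvGlue.nonneg _) (expNegInvGlue.nonneg _))

/-- For `x ≥ 1`, `p x = κ E(x - 1)`. [folklore] -/
theorem pf_of_one_le {x : ℝ} (hx : 1 ≤ x) : pf η x = kap η * expNegInvGlue (x - 1) := by
  unfold pf; rw [expNegInvGlue.zero_of_nonpos (by linarith : -x - 1 ≤ 0), add_zero]

/-- `0 < p x` for `|x| > 1`. [folklore] -/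
theorem pf_pos {x : ℝ} (hx : 1 < |x|) : 0 < pf η x := by
  rcases le_or_gt 0 x with h | h
  · rw [abs_of_nonneg h] at hx
    rw [pf_of_one_le η hx.le]
    exact mul_pos (kap_pos η) (expNegInvGlue.pos_of_pos (by linarith))
  · rw [abs_of_neg h] at hx
    rw [← pf_neg, pf_of_one_le η hx.le]
    exact mul_pos (kap_pos η) (expNegInvGlue.pos_of_pos (by linarith))

/-- `p` is smooth. [folklore] -/
theorem contDiff_pf : ContDiff ℝ ∞ (pf η) := by
  unfold pf
  exact contDiff_const.mul ((expNegInvGlue.contDiff.comp (contDiff_id.sub contDiff_const)).add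
    (expNegInvGlue.contDiff.comp (contDiff_neg.sub contDiff_const)))

/-- The derivative of `p`. [folklore] -/
def pf' (x : ℝ) : ℝ :=
  kap η * ((x - 1)⁻¹ ^ 2 * expNegInvGlue (x - 1) - (-x - 1)⁻¹ ^ 2 * expNegInvGlue (-x - 1))

/-- `p` has derivative `p'`. [folklore] -/
theorem hasDerivAt_pf (x : ℝ) : HasDerivAt (pf η) (pf' η x) x := by
  unfold pf pf'
  have h1 : HasDerivAt (fun x => expNegInvGlue (x - 1)) ((x - 1)⁻¹ ^ 2 * expNegInvGlue (x - 1)) x := by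
    have := (hasDerivAt_expNegInvGlue (x - 1)).comp x ((hasDerivAt_id' x).sub_const 1)
    rw [mul_one] at this
    exact this
  have h2 := (hasDerivAt_expNegInvGlue (-x - 1)).comp x ((hasDerivAt_neg' x).sub_const 1)
  have h3 := (h1.add h2).const_mul (kap η)
  have heq : kap η * ((x - 1)⁻¹ ^ 2 * expNegInvGlue (x - 1) +
      (-x - 1)⁻¹ ^ 2 * expNegInvGlue (-x - 1) * (-1)) =
      kap η * ((x - 1)⁻¹ ^ 2 * expNegInvGlue (x - 1) - (-x - 1)⁻¹ ^ 2 * expNegInvGlue (-x - 1)) := by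
    ring
  rw [heq] at h3
  exact h3

/-- `p' = 0` on `[-1, 1]`. [folklore] -/
theorem pf'_eq_zero {x : ℝ} (hx : |x| ≤ 1) : pf' η x = 0 := by
  rw [abs_le] at hx
  unfold pf'
  rw [expNegInvGlue.zero_of_nonpos (by linarith : x - 1 ≤ 0),
    expNegInvGlue.zero_of_nonpos (by linarith : -x - 1 ≤ 0)]
  ring

/-- `p' > 0` for `x > 1`. [folklore] -/
theorem pf'_pos {x : ℝ} (hx : 1 < x) : 0 < pf' η x := by
  unfold pf'
  rw [expNegInvGlue.zero_of_nonpos (by linarith : -x - 1 ≤ 0), mul_zero, sub_zero]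
  exact mul_pos (kap_pos η) (deriv_expNegInvGlue_pos (by linarith))

/-- `p' < 0` for `x < -1`. [folklore] -/
theorem pf'_neg {x : ℝ} (hx : x < -1) : pf' η x < 0 := by
  unfold pf'
  rw [expNegInvGlue.zero_of_nonpos (by linarith : x - 1 ≤ 0), mul_zero, zero_sub]
  exact mul_neg_of_pos_of_neg (kap_pos η) (neg_neg_of_pos (deriv_expNegInvGlue_pos (by linarith)))

/-- `p' ≠ 0` for `|x| > 1`. [folklore] -/
theorem pf'_ne_zero {x : ℝ} (hx : 1 < |x|) : pf' η x ≠ 0 := by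
  rcases le_or_gt 0 x with h | h
  · rw [abs_of_nonneg h] at hx; exact (pf'_pos η hx).ne'
  · rw [abs_of_neg h] at hx; exact (pf'_neg η (by linarith)).ne

/-- `p` is monotone in `|x|`: `p x ≤ p x'` for `1 ≤ x ≤ x'`. [folklore] -/
theorem pf_le_pf {x x' : ℝ} (hx : 1 ≤ x) (hxx' : x ≤ x') : pf η x ≤ pf η x' := by
  rw [pf_of_one_le η hx, pf_of_one_le η (hx.trans hxx')]
  exact mul_le_mul_of_nonneg_left (expNegInvGlue.monotone (by linarith)) (kap_pos η).le

/-- `p` is strictly increasing on `[1, ∞)`. [folklore] -/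
theorem pf_lt_pf {x x' : ℝ} (hx : 1 ≤ x) (hxx' : x < x') : pf η x < pf η x' := by
  rw [pf_of_one_le η hx, pf_of_one_le η (hx.trans hxx'.le)]
  exact mul_lt_mul_of_pos_left (expNegInvGlue_lt_of_lt (by linarith) (by linarith)) (kap_pos η)

variable {η}

/-- **The caps close inside the end zones**: `p x ≥ w² + 1` for `|x| ≥ 1 + η/4` (`η > 0`).
[folklore] -/
theorem pf_ge_of_le_abs (hη : 0 < η) {x : ℝ} (hx : 1 + η / 4 ≤ |x|) : w ^ 2 + 1 ≤ pf η x := by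
  wlog h : 0 ≤ x generalizing x
  · have := this (x := -x) (by rwa [abs_neg]) (by linarith [le_of_not_ge h])
    rwa [pf_neg] at this
  rw [abs_of_nonneg h] at hx
  have hx1 : 1 ≤ x := by linarith
  rw [pf_of_one_le η hx1]
  have hE : expNegInvGlue (η / 4) ≤ expNegInvGlue (x - 1) := expNegInvGlue.monotone (by linarith)
  have hval : expNegInvGlue (η / 4) = exp (-(4 / η)) := by
    rw [expNegInvGlue_of_pos (by positivity)]
    congr 1
    field_simp
  calc w ^ 2 + 1 = kap η * expNegInvGlue (η / 4) := by
        rw [kap, hval, mul_assoc, ← exp_add, add_neg_cancel, exp_zero, mul_one]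
    _ ≤ kap η * expNegInvGlue (x - 1) := mul_le_mul_of_nonneg_left hE (kap_pos η).le

/-! ### The model function `v₀` -/

variable (η)

/-- **The model function** `v₀(x + iy) = y² + 2wy + p(x)`; its zero loop has top edge the core
segment `[-1, 1] × {0}` and bottom edge `[-1, 1] × {-2w}`. [cite: Hatcher2025, Handle Smoothing Theorem (1)] -/
def v0 (z : ℂ) : ℝ := z.im ^ 2 + 2 * w * z.im + pf η z.re

/-- `v₀` in the middle region `|x| ≤ 1`: `v₀ = y² + 2wy = (y + w)² - w²`. [folklore] -/
theorem v0_of_abs_re_le_one {z : ℂ} (hz : |z.re| ≤ 1) : v0 η z = (z.im + w) ^ 2 - w ^ 2 := by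
  unfold v0; rw [pf_eq_zero η hz]; ring

/-- `v₀ = (y + w)² - w² + p(x)`. [folklore] -/
theorem v0_eq (z : ℂ) : v0 η z = (z.im + w) ^ 2 - w ^ 2 + pf η z.re := by unfold v0; ring

/-- `v₀ ≥ -w²`. [folklore] -/
theorem neg_sq_le_v0 (z : ℂ) : -w ^ 2 ≤ v0 η z := by
  rw [v0_eq]; nlinarith [sq_nonneg (z.im + w), pf_nonneg η z.re]

/-- `v₀` is smooth. [folklore] -/
theorem contDiff_v0 : ContDiff ℝ ∞ (v0 η) := by
  unfold v0
  have him : ContDiff ℝ ∞ (fun z : ℂ => z.im) := Complex.imCLM.contDiff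
  have hre : ContDiff ℝ ∞ (fun z : ℂ => z.re) := Complex.reCLM.contDiff
  exact ((him.pow 2).add (contDiff_const.mul him)).add ((contDiff_pf η).comp hre)

/-- `v₀` is continuous. [folklore] -/
theorem continuous_v0 : Continuous (v0 η) := (contDiff_v0 η).continuous

/-- **The derivative of `v₀`**: `dv₀ = p'(x) dx + 2 (y + w) dy`. [folklore] -/
theorem hasFDerivAt_v0 (z : ℂ) :
    HasFDerivAt (v0 η) (pf' η z.re • Complex.reCLM + (2 * (z.im + w)) • Complex.imCLM) z := by
  unfold v0
  have him : HasFDerivAt (fun z : ℂ => z.im) Complex.imCLM z := Complex.imCLM.hasFDerivAt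
  have hre : HasFDerivAt (fun z : ℂ => z.re) Complex.reCLM z := Complex.reCLM.hasFDerivAt
  have h1 : HasFDerivAt (fun z : ℂ => z.im ^ 2) ((2 * z.im) • Complex.imCLM) z := by
    simpa using him.pow 2
  have h2 : HasFDerivAt (fun z : ℂ => 2 * w * z.im) ((2 * w) • Complex.imCLM) z := him.const_mul (2 * w)
  have h3 : HasFDerivAt (fun z : ℂ => pf η z.re) (pf' η z.re • Complex.reCLM) z :=
    (hasDerivAt_pf η z.re).comp_hasFDerivAt z hre
  have hsum := (h1.add h2).add h3
  have heq : (2 * z.im) • Complex.imCLM + (2 * w) • Complex.imCLM + pf' η z.re • Complex.reCLM =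
      pf' η z.re • Complex.reCLM + (2 * (z.im + w)) • Complex.imCLM := by
    ext v
    simp
    ring
  rw [heq] at hsum
  exact hsum

/-- The derivative of `v₀` applied to a vector. [folklore] -/
theorem fderiv_v0_apply (z v : ℂ) : fderiv ℝ (v0 η) z v = pf' η z.re * v.re + 2 * (z.im + w) * v.im := by
  rw [(hasFDerivAt_v0 η z).fderiv]
  simp

/-- **The critical points of `v₀`** are exactly the points of the segment `{y = -w, |x| ≤ 1}`.
[folklore] -/
theorem fderiv_v0_eq_zero_iff (z : ℂ) : fderiv ℝ (v0 η) z = 0 ↔ z.im = -w ∧ |z.re| ≤ 1 := by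
  constructor
  · intro h
    have h1 := congrArg (fun L : ℂ →L[ℝ] ℝ => L 1) h
    have hI := congrArg (fun L : ℂ →L[ℝ] ℝ => L Complex.I) h
    simp only [fderiv_v0_apply, Complex.one_re, mul_one, Complex.one_im, mul_zero, add_zero,
      Complex.I_re, Complex.I_im, zero_add] at h1 hI
    have h1' : pf' η z.re = 0 := h1
    have hI' : 2 * (z.im + w) = 0 := hI
    refine ⟨by linarith, ?_⟩
    by_contra hx
    exact pf'_ne_zero η (not_le.1 hx) h1'
  · rintro ⟨hy, hx⟩
    ext v
    simp [fderiv_v0_apply, pf'_eq_zero η hx, hy]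

/-- Away from the critical segment the derivative of `v₀` is nonzero. [folklore] -/
theorem fderiv_v0_ne_zero {z : ℂ} (h : z.im ≠ -w ∨ 1 < |z.re|) : fderiv ℝ (v0 η) z ≠ 0 := by
  rw [Ne, fderiv_v0_eq_zero_iff]
  rintro ⟨hy, hx⟩
  rcases h with h | h
  · exact h hy
  · exact absurd hx (not_le.2 h)

/-- At a critical point the value of `v₀` is `-w²`; hence every level above `-w²` is regular.
[folklore] -/
theorem fderiv_v0_ne_zero_of_lt {z : ℂ} (h : -w ^ 2 < v0 η z) : fderiv ℝ (v0 η) z ≠ 0 := by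
  refine fderiv_v0_ne_zero η ?_
  by_contra hcon
  push Not at hcon
  obtain ⟨hy, hx⟩ := hcon
  rw [v0_of_abs_re_le_one η hx, hy] at h
  simp at h

/-! ### The levels in the middle region -/

/-- The height of the top edge of the loop `v₀ = c` in the middle region: `-w + √(w² + c)`.
[folklore] -/
def yt (c : ℝ) : ℝ := -w + Real.sqrt (w ^ 2 + c)

/-- The height of the bottom edge of the loop `v₀ = c` in the middle region: `-w - √(w² + c)`.
[folklore] -/
def yb (c : ℝ) : ℝ := -w - Real.sqrt (w ^ 2 + c)

/-- The core is the top edge of the zero loop: `yt 0 = 0`. [folklore] -/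
@[simp] theorem yt_zero : yt 0 = 0 := by
  rw [yt, add_zero, Real.sqrt_sq w_pos.le]; ring

/-- `yb 0 = -2w`. [folklore] -/
@[simp] theorem yb_zero : yb 0 = -2 * w := by
  rw [yb, add_zero, Real.sqrt_sq w_pos.le]; ring

/-- `yt` is strictly increasing on `[-w², ∞)`. [folklore] -/
theorem yt_lt_yt {c c' : ℝ} (hc : -w ^ 2 ≤ c) (hcc' : c < c') : yt c < yt c' := by
  unfold yt
  have := Real.sqrt_lt_sqrt (by linarith) (by linarith : w ^ 2 + c < w ^ 2 + c')
  linarith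

/-- `yb` is strictly decreasing on `[-w², ∞)`. [folklore] -/
theorem yb_lt_yb {c c' : ℝ} (hc : -w ^ 2 ≤ c) (hcc' : c < c') : yb c' < yb c := by
  unfold yb
  have := Real.sqrt_lt_sqrt (by linarith) (by linarith : w ^ 2 + c < w ^ 2 + c')
  linarith

/-- `yb c ≤ -w ≤ yt c`. [folklore] -/
theorem yb_le_neg_w (c : ℝ) : yb c ≤ -w := by
  unfold yb; linarith [Real.sqrt_nonneg (w ^ 2 + c)]

/-- `-w ≤ yt c`. [folklore] -/
theorem neg_w_le_yt (c : ℝ) : -w ≤ yt c := by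
  unfold yt; linarith [Real.sqrt_nonneg (w ^ 2 + c)]

/-- `yb c < yt c` for `c > -w²`. [folklore] -/
theorem yb_lt_yt {c : ℝ} (hc : -w ^ 2 < c) : yb c < yt c := by
  unfold yb yt
  have := Real.sqrt_pos.2 (by linarith : 0 < w ^ 2 + c)
  linarith

/-- `(yt c + w)² = w² + c` for `c ≥ -w²`. [folklore] -/
theorem yt_add_w_sq {c : ℝ} (hc : -w ^ 2 ≤ c) : (yt c + w) ^ 2 = w ^ 2 + c := by
  unfold yt
  rw [show -w + Real.sqrt (w ^ 2 + c) + w = Real.sqrt (w ^ 2 + c) by ring, Real.sq_sqrt (by linarith)]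

/-- `(yb c + w)² = w² + c` for `c ≥ -w²`. [folklore] -/
theorem yb_add_w_sq {c : ℝ} (hc : -w ^ 2 ≤ c) : (yb c + w) ^ 2 = w ^ 2 + c := by
  unfold yb
  rw [show -w - Real.sqrt (w ^ 2 + c) + w = -Real.sqrt (w ^ 2 + c) by ring, neg_sq,
    Real.sq_sqrt (by linarith)]

/-- **The levels of `v₀` in the middle region** `|x| ≤ 1` are pairs of horizontal lines: for
`c > -w²`, `v₀ z = c ↔ (y = yt c ∨ y = yb c)`. [folklore] -/
theorem v0_eq_iff_of_abs_re_le_one {z : ℂ} (hz : |z.re| ≤ 1) {c : ℝ} (hc : -w ^ 2 < c) :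
    v0 η z = c ↔ z.im = yt c ∨ z.im = yb c := by
  rw [v0_of_abs_re_le_one η hz]
  have hs : 0 < Real.sqrt (w ^ 2 + c) := Real.sqrt_pos.2 (by linarith)
  have hs2 : Real.sqrt (w ^ 2 + c) ^ 2 = w ^ 2 + c := Real.sq_sqrt (by linarith)
  constructor
  · intro h
    have h' : (z.im + w) ^ 2 = Real.sqrt (w ^ 2 + c) ^ 2 := by rw [hs2]; linarith
    rcases sq_eq_sq_iff_eq_or_eq_neg.1 h' with h1 | h1
    · left; unfold yt; linarith
    · right; unfold yb; linarith
  · rintro (h | h)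
    · rw [h, yt_add_w_sq hc.le]; ring
    · rw [h, yb_add_w_sq hc.le]; ring

/-- In the middle region, `v₀ z ≤ c ↔ yb c ≤ y ≤ yt c` (`c ≥ -w²`). [folklore] -/
theorem v0_le_iff_of_abs_re_le_one {z : ℂ} (hz : |z.re| ≤ 1) {c : ℝ} (hc : -w ^ 2 ≤ c) :
    v0 η z ≤ c ↔ yb c ≤ z.im ∧ z.im ≤ yt c := by
  rw [v0_of_abs_re_le_one η hz]
  have hs0 : 0 ≤ Real.sqrt (w ^ 2 + c) := Real.sqrt_nonneg _
  have hs2 : Real.sqrt (w ^ 2 + c) ^ 2 = w ^ 2 + c := Real.sq_sqrt (by linarith)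
  unfold yb yt
  constructor
  · intro h
    have h' : (z.im + w) ^ 2 ≤ Real.sqrt (w ^ 2 + c) ^ 2 := by rw [hs2]; linarith
    have := abs_le_of_sq_le_sq' h' hs0
    constructor <;> linarith [this.1, this.2]
  · rintro ⟨h1, h2⟩
    have := sq_le_sq' (a := z.im + w) (b := Real.sqrt (w ^ 2 + c)) (by linarith) (by linarith)
    linarith [hs2]

/-- In the middle region, `c ≤ v₀ z ↔ (y ≤ yb c ∨ yt c ≤ y)` (`c ≥ -w²`). [folklore] -/
theorem le_v0_iff_of_abs_re_le_one {z : ℂ} (hz : |z.re| ≤ 1) {c : ℝ} (hc : -w ^ 2 ≤ c) :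
    c ≤ v0 η z ↔ z.im ≤ yb c ∨ yt c ≤ z.im := by
  rw [v0_of_abs_re_le_one η hz]
  have hs0 : 0 ≤ Real.sqrt (w ^ 2 + c) := Real.sqrt_nonneg _
  have hs2 : Real.sqrt (w ^ 2 + c) ^ 2 = w ^ 2 + c := Real.sq_sqrt (by linarith)
  unfold yb yt
  constructor
  · intro h
    have h' : Real.sqrt (w ^ 2 + c) ^ 2 ≤ (z.im + w) ^ 2 := by rw [hs2]; linarith
    have key : Real.sqrt (w ^ 2 + c) ≤ |z.im + w| := by
      have := Real.sqrt_le_sqrt h'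
      rwa [Real.sqrt_sq hs0, Real.sqrt_sq_eq_abs] at this
    rcases le_or_gt 0 (z.im + w) with h0 | h0
    · right; rw [abs_of_nonneg h0] at key; linarith
    · left; rw [abs_of_neg h0] at key; linarith
  · rintro (h | h)
    · have : Real.sqrt (w ^ 2 + c) ≤ -(z.im + w) := by linarith
      nlinarith [hs2, this, hs0]
    · have : Real.sqrt (w ^ 2 + c) ≤ z.im + w := by linarith
      nlinarith [hs2, this, hs0]

/-! ### A priori bounds -/

/-- **The loops `v₀ < 1` lie in `|x| < 1 + η/4`.** [folklore] -/
theorem abs_re_lt_of_v0_lt_one (hη : 0 < η) {z : ℂ} (hz : v0 η z < 1) : |z.re| < 1 + η / 4 := by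
  by_contra h
  rw [not_lt] at h
  have := pf_ge_of_le_abs hη h
  rw [v0_eq] at hz
  nlinarith [sq_nonneg (z.im + w)]

/-- On `|y| ≥ 1`, `v₀ ≥ 3/4`. [folklore] -/
theorem v0_ge_of_one_le_abs_im {z : ℂ} (hz : 1 ≤ |z.im|) : 3 / 4 ≤ v0 η z := by
  rw [v0_eq]
  have hw := w_lt
  have hw0 := w_pos
  have hp := pf_nonneg η z.re
  have hw8 : w = 1 / 8 := w_eq
  rcases le_or_gt 0 z.im with h | h
  · rw [abs_of_nonneg h] at hz
    have h2 : (1 + w) ^ 2 ≤ (z.im + w) ^ 2 :=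
      pow_le_pow_left₀ (by linarith) (by linarith : 1 + w ≤ z.im + w) 2
    have h3 : (1 + w) ^ 2 - w ^ 2 = 1 + 2 * w := by ring
    linarith
  · rw [abs_of_neg h] at hz
    have h2 : (1 - w) ^ 2 ≤ (z.im + w) ^ 2 := by
      have := pow_le_pow_left₀ (by linarith) (by linarith : 1 - w ≤ -(z.im + w)) 2
      rwa [neg_sq] at this
    have h3 : (1 - w) ^ 2 - w ^ 2 = 1 - 2 * w := by ring
    linarith

/-- On `|x| ≥ 1 + η/4`, `v₀ ≥ 1`. [folklore] -/
theorem one_le_v0_of_le_abs_re (hη : 0 < η) {z : ℂ} (hz : 1 + η / 4 ≤ |z.re|) : 1 ≤ v0 η z := by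
  rw [v0_eq]
  nlinarith [pf_ge_of_le_abs hη hz, sq_nonneg (z.im + w)]

/-- **The thin set is in the open box**: if `|v₀ z| < 3/4` then `|y| < 1`, and if moreover `η > 0`
then `|x| < 1 + η/4`. [folklore] -/
theorem abs_im_lt_one_of_abs_v0_lt {z : ℂ} (hz : |v0 η z| < 3 / 4) : |z.im| < 1 := by
  by_contra h
  rw [not_lt] at h
  have := v0_ge_of_one_le_abs_im η h
  rw [abs_lt] at hz
  linarith [hz.2]

/-- `3 ε < 3/4` and `3 ε < w²`: the thin band is thin. [folklore] -/
theorem three_eps_lt : 3 * eps < w ^ 2 / 4 := by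
  rw [eps_eq]; nlinarith [pow_pos w_pos 2]

/-- **The two strips.** In the middle region `|x| ≤ 1`, `|v₀ z| ≤ 3ε` forces `|y| ≤ w/8` or
`|y + 2w| ≤ w/8`. [folklore] -/
theorem abs_im_le_or_of_abs_v0_le {z : ℂ} (hz : |z.re| ≤ 1) (hv : |v0 η z| ≤ 3 * eps) :
    |z.im| ≤ w / 8 ∨ |z.im + 2 * w| ≤ w / 8 := by
  rw [v0_of_abs_re_le_one η hz, abs_le] at hv
  obtain ⟨h1, h2⟩ := hv
  have hw := w_pos
  rw [eps_eq] at h1 h2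
  -- `(y + w)² ∈ [w² - 3ε, w² + 3ε]`, `3ε = 3w²/16`
  set s := z.im + w with hs
  have hlo : w ^ 2 * (13 / 16) ≤ s ^ 2 := by nlinarith
  have hhi : s ^ 2 ≤ w ^ 2 * (19 / 16) := by nlinarith
  rcases le_or_gt 0 s with h0 | h0
  · -- `s ≥ 0`: `s ∈ [w √(13/16), w √(19/16)] ⊆ [7w/8, 9w/8]`
    left
    rw [abs_le]
    have hs1 : w * (7 / 8) ≤ s := by nlinarith
    have hs2 : s ≤ w * (9 / 8) := by nlinarith
    constructor <;> linarith
  · right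
    rw [abs_le]
    have hs1 : w * (7 / 8) ≤ -s := by nlinarith
    have hs2 : -s ≤ w * (9 / 8) := by nlinarith
    constructor <;> linarith

/-- The two strips are disjoint: no `y` has both `|y| ≤ w/8` and `|y + 2w| ≤ w/8`. [folklore] -/
theorem not_both_strips (y : ℝ) : ¬ (|y| ≤ w / 8 ∧ |y + 2 * w| ≤ w / 8) := by
  rintro ⟨h1, h2⟩
  rw [abs_le] at h1 h2
  linarith [w_pos, h1.1, h2.2]

/-- The core lies strictly inside the thin band: `|v₀ (x)| = 0 < 3ε` on `[-1,1] × {0}`.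
[folklore] -/
theorem v0_ofReal {x : ℝ} (hx : |x| ≤ 1) : v0 η (x : ℂ) = 0 := by
  rw [v0_of_abs_re_le_one η (by simpa using hx)]
  simp

end HandleOne

end Literature.Topology.FourManifolds
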